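import Literature.Computability.Complexity.CatalyticSpaceLogspace
import HarnessLib

/-!
# The trivial languages in space `1`: `∅, univ ∈ SpaceClass 1 ⊆ LOGSPACE ⊆ CL`

Non-vacuity of the tree's space classes (`SpaceClass`, `LOGSPACE`, `Space.lean`) and of catalytic
logspace (`CL`, `CatalyticSpace.lean`): the **constant-answer space machine**
`ConstAnswer.machine b` (three Boolean stacks `inp`, `out`, `left`; one statement `push out b;
halt`) decides, in work space `1` and without ever reading its input, every language whose
indicator is constantly `b` (`ConstAnswer.decidesInSpace`). Hence `empty_mem_spaceClass_one`,
`univ_mem_spaceClass_one`, `spaceClass_one_subset_LOGSPACE`, `empty_mem_LOGSPACE`,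
`univ_mem_LOGSPACE`, and — through `LOGSPACE_subset_CL` (`CatalyticSpaceLogspace.lean`) —
`empty_mem_CL`, `univ_mem_CL` (the sanity clause asked of every capture class on this tree: the
halting, restoration and space clauses of `CatalyticDecides` are satisfiable, and by honest
machines). The machine is written in the style of the tree's concrete machines
(`UnaryArithMachines.lean`: canonical instances, a stack-assignment function `stk`, `cfg`,
one `step_…` lemma per statement, runs through `SpaceLoop.RunsVia`).

## References

* S. Arora, B. Barak, *Computational Complexity: A Modern Approach*, CUP 2009, Def. 4.1 (SPACE),
  Def. 4.5 (L) [AroraBarak2009].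
* M. Koucký, I. Mertz, E. Pyne, S. Sami, *Collapsing catalytic classes*, 2025, §1 (`L ⊆ CL`)
  [KouckyEtAl2025].
-/

noncomputable section

namespace Literature.Computability.Complexity

open _root_.Computability Turing StateTransition Function

/-! ### The constant-answer space machines: `∅, univ ∈ LOGSPACE ⊆ CL` -/

namespace ConstAnswer

/-- The three stacks of the constant-answer machine: input, output, left input. [folklore] -/
inductive K3
  | inp
  | out
  | left
  deriving DecidableEq, Fintype

/-- The program: one statement `push out b; halt` at the unique label. [folklore] -/
def prog (b : Bool) : Unit → TM2.Stmt (fun _ : K3 => Bool) Unit Unit :=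
  fun _ => TM2.Stmt.push K3.out (fun _ => b) TM2.Stmt.halt

/-- The constant-answer machine with answer `b` (canonical instances, as in
`UnaryArithMachines.lean`). [folklore] -/
def tm (b : Bool) : FinTM2 where
  K := K3
  kDecidableEq := inferInstance
  kFin := inferInstance
  k₀ := K3.inp
  k₁ := K3.out
  Γ := fun _ => Bool
  Λ := Unit
  main := ()
  ΛFin := inferInstance
  σ := Unit
  initialState := ()
  σFin := inferInstance
  Γk₀Fin := inferInstanceAs (Fintype Bool)
  m := prog b

/-- The constant-answer machine as a space machine (read-only input on `left`/`inp`, never read;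
all alphabet identifications the identity). [folklore] -/
def machine (b : Bool) : SpaceMachine Bool Bool where
  tm := tm b
  inputAlphabet := Equiv.refl Bool
  outputAlphabet := Equiv.refl Bool
  kL := K3.left
  kL_ne_k₀ := fun h => K3.noConfusion h
  kL_ne_k₁ := fun h => K3.noConfusion h
  leftAlphabet := Equiv.refl Bool

/-- Stack assignment. [folklore] -/
def stk (i o l : List Bool) : K3 → List Bool
  | .inp => i
  | .out => o
  | .left => l

/-- The input stack. [folklore] -/
@[simp] theorem stk_inp (i o l : List Bool) : stk i o l K3.inp = i := rfl
/-- The output stack. [folklore] -/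
@[simp] theorem stk_out (i o l : List Bool) : stk i o l K3.out = o := rfl
/-- The left input stack. [folklore] -/
@[simp] theorem stk_left (i o l : List Bool) : stk i o l K3.left = l := rfl
/-- Updating the output stack. [folklore] -/
@[simp] theorem update_stk_out (i o l o' : List Bool) :
    Function.update (stk i o l) K3.out o' = stk i o' l := by funext k; cases k <;> rfl

variable (b : Bool)

/-- Configurations. [folklore] -/
def cfg (lab : Option Unit) (i o l : List Bool) : (tm b).Cfg := ⟨lab, (), stk i o l⟩

/-- The step function with canonical instances. [folklore] -/
theorem tm_step (c : (tm b).Cfg) : (tm b).step c = TM2.step (prog b) c := rfl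

/-- The single step: push the answer, halt. [folklore] -/
theorem step_main (i o l : List Bool) :
    (tm b).step (cfg b (some ()) i o l) = some (cfg b none i (b :: o) l) := by
  rw [tm_step]; simp [cfg, TM2.step, prog, TM2.stepAux]; rfl

/-- The machine does not move after its step. [folklore] -/
theorem step_halt (i o l : List Bool) : (tm b).step (cfg b none i o l) = none := rfl

/-- The initial configuration. [folklore] -/
theorem init_eq (x : List Bool) : (machine b).init x = cfg b (some ()) x [] [] := by
  refine TM2.Cfg.mk.injEq _ _ _ _ _ _ |>.mpr ⟨rfl, rfl, ?_⟩
  funext k; cases k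
  · exact (SpaceMachine.init_stk_k₀ (machine b) x).trans (List.map_id x)
  · exact SpaceMachine.init_stk_of_ne (machine b) x (k := K3.out) (fun h => K3.noConfusion h)
  · exact SpaceMachine.init_stk_of_ne (machine b) x (k := K3.left) (fun h => K3.noConfusion h)

/-- The work space of a configuration is the length of the output stack (the only work stack).
[folklore] -/
theorem workSpace_cfg (lab : Option Unit) (i o l : List Bool) :
    (machine b).workSpace (cfg b lab i o l) = o.length := by
  change ∑ k ∈ ((Finset.univ : Finset K3).erase K3.inp).erase K3.left, (stk i o l k).length = _
  rw [show ((Finset.univ : Finset K3).erase K3.inp).erase K3.left = {K3.out} by decide,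
    Finset.sum_singleton, stk_out]

/-- A configuration with empty left input stack spells the word on its input stack. [folklore] -/
theorem inputOf_cfg (lab : Option Unit) (i o : List Bool) :
    (machine b).inputOf (cfg b lab i o []) = i := by
  change ([] : List Bool).reverse ++ List.map id i = i
  rw [List.map_id]
  rfl

/-- **The constant-answer machine decides, in work space `1`, every language whose indicator is
constantly `b`.** [folklore] -/
theorem decidesInSpace {L : Language Bool} (hL : ∀ x, L.boolIndicator x = b) :
    DecidesInSpace (machine b) L (fun _ => 1) := by
  have run : ∀ x : List Bool, SpaceLoop.RunsVia (tm b).step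
      (fun c => (machine b).inputOf c = x ∧ (machine b).workSpace c ≤ 1)
      ((machine b).init x) (cfg b none x [b] []) := by
    intro x
    rw [init_eq]
    refine SpaceLoop.RunsVia.single (step_main b x [] []) ⟨inputOf_cfg b _ x [], ?_⟩
      ⟨inputOf_cfg b _ x [b], ?_⟩
    · rw [workSpace_cfg]; simp
    · rw [workSpace_cfg]; simp
  refine ⟨fun x c hc => ((run x).forall_reaches (step_halt b x [b] []) c hc).1,
    fun x => ⟨⟨cfg b none x [b] [], (run x).mem_eval (step_halt b x [b] []), ?_⟩,
      fun c hc => ((run x).forall_reaches (step_halt b x [b] []) c hc).2⟩⟩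
  change [b] = encodeBool (L.boolIndicator x)
  rw [hL x]
  rfl

end ConstAnswer

/-- `∅ ∈ SpaceClass 1`. [folklore] -/
theorem empty_mem_spaceClass_one : (∅ : Set (List Bool)) ∈ SpaceClass fun _ => 1 :=
  ⟨ConstAnswer.machine false, ConstAnswer.decidesInSpace false fun x =>
    (Set.notMem_iff_boolIndicator (s := (∅ : Set (List Bool))) x).1 (Set.notMem_empty x)⟩

/-- `univ ∈ SpaceClass 1`. [folklore] -/
theorem univ_mem_spaceClass_one : (Set.univ : Set (List Bool)) ∈ SpaceClass fun _ => 1 :=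
  ⟨ConstAnswer.machine true, ConstAnswer.decidesInSpace true fun x =>
    (Set.mem_iff_boolIndicator (s := (Set.univ : Set (List Bool))) x).1 (Set.mem_univ x)⟩

/-- `SpaceClass 1 ⊆ LOGSPACE` (constant `1`). [cite: AroraBarak2009, Def. 4.5] -/
theorem spaceClass_one_subset_LOGSPACE : (SpaceClass fun _ => 1) ⊆ LOGSPACE :=
  fun _ hL => ⟨1, spaceClass_mono (fun n => by omega) hL⟩

/-- `∅ ∈ LOGSPACE`. [folklore] -/
theorem empty_mem_LOGSPACE : (∅ : Set (List Bool)) ∈ LOGSPACE :=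
  spaceClass_one_subset_LOGSPACE empty_mem_spaceClass_one

/-- `univ ∈ LOGSPACE`. [folklore] -/
theorem univ_mem_LOGSPACE : (Set.univ : Set (List Bool)) ∈ LOGSPACE :=
  spaceClass_one_subset_LOGSPACE univ_mem_spaceClass_one

/-- **Non-vacuity of `CL`: `∅ ∈ CL`.** [cite: KouckyEtAl2025, §1 (L ⊆ CL)] -/
theorem empty_mem_CL : (∅ : Set (List Bool)) ∈ CL :=
  LOGSPACE_subset_CL empty_mem_LOGSPACE

/-- **Non-vacuity of `CL`: `univ ∈ CL`.** [cite: KouckyEtAl2025, §1 (L ⊆ CL)] -/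
theorem univ_mem_CL : (Set.univ : Set (List Bool)) ∈ CL :=
  LOGSPACE_subset_CL univ_mem_LOGSPACE

end Literature.Computability.Complexity

end
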